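/-
Copyright: cell `langlands-arthur-audit` (papers/Langlands/langlands-arthur-audit), units `pub-arthur-typer`
(gen 1, 2026-08-18T14:35Z) and `pub-arthur-typer-g2` (this tree version).  Staged for the tree under
`Literature/NumberTheory/Automorphic/Arthur2013/` (LEAN-IN-TREE rule 2026-08-18) from the cell module
`HOME/lean/ArthurAudit/ArthurAudit/Leaves.lean` (core Lean): namespace renamed, `import HarnessLib` added for the
gate's audit commands, one provenance tag per declaration, every quotation re-verified against the staged TeX
sources (two gen-1 misquotations corrected: CITED-FACTS TY-1, GAPS G-TY-5), the 2026 status TABLE removed (the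
cell keeps ONE table: module `Upstream`), the local classification statement and the complex-place findings added.
-/
import Literature.NumberTheory.Automorphic.Arthur2013.Leaves.Scopes

/-!
# Arthur (2013) audit, typed leaves — §5–§6 packets, ECR, local classification, intertwining

§5: parameters, component groups, packets and the endoscopic character relation ([AGIKMS] §2.5), the local classification statement `LocalClassification` with the regions stated by the Book, [Mok], [KMSW]; §6: the intertwining leaves L16–L19 ([A25]–[A27]) and their 2026 suppliers.
Overview, sources, design and conventions: the module docstring of `Leaves/Scopes.lean` (same directory).
Schematic simplifications: the cell's `DIVERGENCE.md` (D-TY-01 … D-TY-21).  No `axiom`, `sorry`, `opaque`.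
-/

set_option autoImplicit false

namespace Literature.NumberTheory.Automorphic.Arthur2013.Leaves

/-! ## §5  Parameters, component groups, packets, ECR ([AGIKMS] §2.5) — typed combinatorics -/

section Packets

/-- **Combinatorial shape of a local parameter** `ψ ∈ Ψ(G)`, [AGIKMS] §2.5, VERBATIM (`note30.tex:L1383–L1385`)
"We decompose \[ \psi = \psi_{\bad} \oplus \psi_{\good} \oplus {}^c\psi_{\bad}^\vee, \]", (`L1391`) "We say
that $\psi$ is \emph{of good parity} if $\psi_\bad = 0$.", (`L1400`) "A_{\psi} = \bigoplus_{i = 1}^t \Z/2\Z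
e(\phi_i, d_i)."  Recorded: `k = t`, the isomorphism class of `φ_i` as an opaque label `lbl i : Λ`,
`dimφ i = dim φ_i`, `d i ≥ 1`, and `dimBad = dim ψ_bad` (DIVERGENCE D-TY-06).
[claim: AGIKMS2024, under-review] (§2.5, l.1383-1400: notation, not a theorem) -/
structure ParamShape (Λ : Type) where
  /-- number `t` of summands `φ_i ⊠ S_{d_i}` of `ψ_good` -/
  k : Nat
  /-- isomorphism class of `φ_i` (opaque label) -/
  lbl : Fin k → Λ
  /-- `dim φ_i` -/
  dimφ : Fin k → Nat
  /-- `d_i` -/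
  d : Fin k → Nat
  /-- `d_i ≥ 1` -/
  d_pos : ∀ i, 0 < d i
  /-- `dim ψ_bad` -/
  dimBad : Nat

namespace ParamShape

variable {Λ : Type}

/-- `N = dim ψ = 2 dim ψ_bad + Σ_i dim(φ_i) d_i`. [claim: AGIKMS2024, under-review] (§2.5 notation) -/
def dim (ψ : ParamShape Λ) : Nat := 2 * ψ.dimBad + ((List.finRange ψ.k).map fun i => ψ.dimφ i * ψ.d i).sum

/-- `ψ` tempered (= generic): all `d_i = 1`. [folklore] (standard: an A-parameter is tempered iff trivial on the Arthur `SL_2`) -/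
def IsTempered (ψ : ParamShape Λ) : Prop := ∀ i, ψ.d i = 1

/-- **Characters of the component group**, [AGIKMS] §2.5, VERBATIM: (`note30.tex:L1403–L1406`) "Let
$A_{\psi}^+$ be the kernel of the homomorphism \[ \det \colon A_{\psi} \rightarrow \Z/2\Z,\, e(\phi_i, d_i)
\mapsto \dim(\phi_i \boxtimes S_{d_i}) \bmod 2. \]"; (`L1407–L1411`) "Define $A_{\psi}^0$ as the subgroup of
$A_{\psi}$ generated by elements of the form $e(\phi_i, d_i)+e(\phi_j, d_j)$ such that $\phi_i \boxtimes S_{d_i}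
\cong \phi_j \boxtimes S_{d_j}$."; (`L1413`) "Finally, set $z_{\psi} = \sum_{i=1}^t e(\phi_i, d_i)$.";
(`L1426–L1462`) "\Sc_{\psi} \cong A_{\psi}/(A_{\psi}^0+\Z/2\Z z_{\psi})" for `G = SO_{2n+1}(F)` and `U_n` (and
for `\tl\Sc_\psi^+` when `G = O_{2n}(F)`), but "\Sc_{\psi} \cong A_{\psi}^+/A_{\psi}^0" for `G = Sp_{2n}(F)`.
TYPED: the quotient `A_ψ/(A_ψ⁰ + ℤ/2ℤ z_ψ)` only (DIVERGENCE D-TY-06: the `Sp_{2n}` variant `A⁺/A⁰` is not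
distinguished).  A character of the elementary abelian 2-group `A_ψ` is its value vector on the basis
`e(φ_i,d_i)` (`true` = `-1`); it descends to the quotient iff it agrees on isomorphic summands and takes the
value `+1` on `z_ψ` (an even number of `-1`'s).
[claim: AGIKMS2024, under-review] (§2.5, l.1403-1466: description of the component group) -/
structure AChar (ψ : ParamShape Λ) where
  /-- value on `e(φ_i, d_i)` (`true` = `-1`) -/
  val : Fin ψ.k → Bool
  /-- trivial on `A_ψ⁰` -/
  triv_A0 : ∀ i j, ψ.lbl i = ψ.lbl j → ψ.d i = ψ.d j → val i = val j
  /-- trivial on `z_ψ` -/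
  triv_z : ((List.finRange ψ.k).filter val).length % 2 = 0

/-- `⟨s_ψ, χ⟩ ∈ {±1}` for (`note30.tex:L1501–L1503`, VERBATIM) "we set \[ s_\psi = \sum_{\substack{1 \leq i
\leq t \\ d_i \equiv 0 \bmod 2}} e(\phi_i,d_i)." — the product of the values of `χ` on the summands with `d_i`
even. [claim: AGIKMS2024, under-review] (§2.5, l.1501-1503) -/
def AChar.atS {ψ : ParamShape Λ} (χ : ψ.AChar) : Val :=
  if ((List.finRange ψ.k).filter fun i => ψ.d i % 2 == 0 && χ.val i).length % 2 = 0
  then 1 else -1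

end ParamShape

/-- **A packet with its pairing** at local classical scope `s` for a parameter of shape `ψ`.  The Book Thm
1.5.1(a) (restated in [TIFR] `[paper:url-560716e7679e p.4]`, VERBATIM): "(a) For any ψ ∈ Ψ̃(G), there is a
finite set Π̃_ψ over Π̃_unit(G), together with a mapping π ∈ Π̃_ψ ⟶ ⟨·, π⟩ ∈ Ŝ_ψ, from Π̃_ψ to the group of
(linear) characters on S_ψ, both of which are canonically determined by endoscopic character relations.";
[AGIKMS] Thm `main3` (1) (`note30.tex:L2349–L2352`): "we can construct an $A$-packet $\Pi_\psi$ together with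
a pairing $\pair{\cdot, \pi}_\psi$ for $\pi \in \Pi_\psi$ which satisfies \eqref{ECR1} and \eqref{ECR2}.
Moreover, $\Pi_\psi$ is a (multiplicity-free) subset of $\Irr(G)$."  `members` is a list read as a finite
multiset over `Irr` (DIVERGENCE D-TY-07).
[cite: Arthur2013, Thm 1.5.1(a) (restated in Arthur's TIFR survey p.4 and AGIKMS2024 l.2349-2352; shape only)] -/
structure Packet (Ω : World) (s : LocalClassicalScope) {Λ : Type} (ψ : ParamShape Λ) where
  /-- the members `Π̃_ψ` (finite multiset over `Irr_unit(G)`) -/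
  members : List (Ω.Irr s)
  /-- the pairing `π ↦ ⟨·, π⟩` -/
  pairing : Ω.Irr s → ψ.AChar

namespace Packet

variable {Ω : World} {s : LocalClassicalScope} {Λ : Type} {ψ : ParamShape Λ}

/-- **(ECR1)** ("our \eqref{ECR1} is the same as the ECR by Arthur \cite[Theorem 2.2.1]{Ar}",
`note30.tex:L1635`), VERBATIM [AGIKMS] `note30.tex:L1494–L1501`: "The equation \[ \tag{{\bf ECR1}}\label{ECR1}
\Theta_{\tl\pi_\psi}(\tl{f}) = \frac{1}{(G:G^\circ)}\sum_{\pi \in \Pi_\psi} \pair{s_\psi, \pi}_\psi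
\Theta_\pi(f_G) \] holds whenever $\tl{f} \in C_c^\infty(\GL_N(E) \rtimes \theta)$ and $f_G \in
C_c^\infty(G^\circ)$ have matching orbital integrals, where $\Theta_\pi$ is the character of $\pi$".  Typed with
the index `(G:G°)` cleared to the left (no division in `Val`, DIVERGENCE D-TY-01).
[cite: Arthur2013, Thm 2.2.1 in the form (ECR1) of AGIKMS2024 l.1494-1501 (restated; formula shape only)] -/
def ECR1 (P : Packet Ω s ψ) (p : Ω.Param s) (indexGG0 : Nat) : Prop :=
  ∀ (fN : Ω.TestGL s) (f : Ω.Test s), Ω.Matches s fN f →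
    (indexGG0 : Val) * Ω.twTrace s p fN =
      (P.members.map fun π => (P.pairing π).atS * Ω.trace s π f).sum

/-- **Thm 1.5.1(b) of the Book, structural part** (restated in [TIFR] p.4, VERBATIM): "(b) Suppose that φ = ψ
lies in the subset Φ̃_bdd(G) of Ψ̃(G). Then the elements in Π̃_φ are tempered and multiplicity free. Moreover,
the mapping from Π̃_φ to Ŝ_φ is injective in general, and bijective in case F is p-adic."  Typed: no repeated
member, pairing injective on members, and — on `p`-ADIC scopes only — every character is attained.
(Temperedness of members is not typed, DIVERGENCE D-TY-08.)
[cite: Arthur2013, Thm 1.5.1(b) (restated in Arthur's TIFR survey p.4; Mok2012 Thm 2.5.1(b) l.1242)] -/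
def TemperedStructure (P : Packet Ω s ψ) : Prop :=
  P.members.Nodup ∧
  (∀ π, π ∈ P.members → ∀ π', π' ∈ P.members → P.pairing π = P.pairing π' → π = π') ∧
  (s.field.isPadic = true → ∀ χ : ψ.AChar, ∃ π, π ∈ P.members ∧ P.pairing π = χ)

end Packet

/-- **Thm 2.2.1(a) of the Book (stable linear form = twisted trace)** (restated in [TIFR]
`[paper:url-560716e7679e p.11]`, VERBATIM): "Theorem 1′ [A, Theorem 2.2.1] (F local). (a) For any ψ ∈ Ψ̃(G),
there is a unique stable linear form f ⟶ f^G(ψ), f ∈ H̃(G), on H̃(G) such that f̃^G(ψ) = f̃_N(ψ), f̃ ∈ H̃(N),"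
(p.12: "The Kottwitz-Shelstad transfer f̃^G of f̃ is defined only as an equivalence class in H̃(G), but its
value f̃^G(ψ) at the putative stable linear form f → f^G(ψ) still makes sense.")  Typed (the identity only;
stability and uniqueness are World data, DIVERGENCE D-TY-09) on a region of local classical scopes:
`twTrace = stableForm` on matching test functions.
[cite: Arthur2013, Thm 2.2.1(a) (restated in Arthur's TIFR survey pp.11-12; identity shape only)] -/
def TwistedCharIdentity (Ω : World) (R : LocalClassicalScope → Prop) : Prop :=
  ∀ s, R s → ∀ (p : Ω.Param s) (fN : Ω.TestGL s) (f : Ω.Test s), Ω.Matches s fN f →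
    Ω.twTrace s p fN = Ω.stableForm s p f

/-- Monotonicity of the twisted character identity in the region. [folklore] (bookkeeping) -/
theorem TwistedCharIdentity.mono (Ω : World) {R R' : LocalClassicalScope → Prop} (h : ∀ s, R' s → R s) :
    TwistedCharIdentity Ω R → TwistedCharIdentity Ω R' :=
  fun H s hs p fN f hm => H s (h s hs) p fN f hm

/-- Bookkeeping data turning the opaque parameters of a world into combinatorial shapes: the shape of each
parameter (labels in `Nat`) and the index `(G : G°)` at each scope (`2` for `O_{2n}`, else `1`).
[folklore] (the audit's own device; DIVERGENCE D-TY-15) -/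
structure ShapeData (Ω : World) where
  /-- the combinatorial shape of a parameter -/
  shape : (s : LocalClassicalScope) → Ω.Param s → ParamShape Nat
  /-- the index `(G : G°)` -/
  indexGG0 : LocalClassicalScope → Nat

/-- **The LOCAL CLASSIFICATION STATEMENT on a region `R`** — the common shape of the Book's Thm 1.5.1 with Thm
2.2.1 ([TIFR] p.4 and p.11 quoted under `Packet`, `Packet.TemperedStructure`, `TwistedCharIdentity`), of [Mok]
Thm 2.5.1 (`src/1206.0882/main.tex:L1242`, VERBATIM: "(b) If $\psi=\phi \in \Phi_{\bdd}(U_{E/F}(N))$ (hence a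
generic parameter of $\Psi(U_{E/F}(N))$), then $\Pi_{\phi}$ is multiplicity free, and all the representations in
$\Pi_{\phi}$ are tempered representations. The mapping from $\Pi_{\phi}$ to $\widehat{\mathcal{S}}_{\phi}$ is
injective, and $\Pi(U_{E/F}(N))$ is the disjoint union of the packets $\Pi_{\phi}$ for all $\phi \in
\Phi(U_{E/F}(N))$.") and of [KMSW] Thm* 1.6.1 (`src/1409.3731/chap1mainthms.tex:L86`, VERBATIM: "The following
local classification theorem is our main local result. In this paper we establish it under the hypothesis that
$\psi$ is generic. The theorem will be proven in full in the next paper \cite{KMS_A}."): for every scope `s` of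
`R` and every parameter there is a packet with pairing satisfying (ECR1) and, for tempered shapes, the tempered
structure.  Exhaustion of `Irr` and the twisted-GL side are not typed (DIVERGENCE D-TY-15).
[cite: Arthur2013, Thm 1.5.1 (statement shape; restated in Mok2012 Thm 2.5.1 l.1230-1242 and KalethaEtAl2014 Thm* 1.6.1)] -/
def LocalClassification (Ω : World) (D : ShapeData Ω) (R : LocalClassicalScope → Prop) : Prop :=
  ∀ s, R s → ∀ p : Ω.Param s, ∃ P : Packet Ω s (D.shape s p),
    P.ECR1 p (D.indexGG0 s) ∧ ((D.shape s p).IsTempered → P.TemperedStructure)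

/-- Monotonicity of the local classification statement in the region. [folklore] (bookkeeping) -/
theorem LocalClassification.mono (Ω : World) (D : ShapeData Ω) {R R' : LocalClassicalScope → Prop}
    (h : ∀ s, R' s → R s) : LocalClassification Ω D R → LocalClassification Ω D R' :=
  fun H s hs p => H s (h s hs) p

/-- Region on which the Book STATES its local classification: quasi-split `SO_{2n+1}`, `Sp_{2n}`, `SO_{2n}^η`
(and `GL_N/F`) over every local field of characteristic zero (all places), all parameters ([TIFR] p.4 "(F
local)"; second-hand, Book not held).
[cite: Arthur2013, Thm 1.5.1 setting (restated in Arthur's TIFR survey p.4 "F local")] -/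
abbrev Book.localStated (s : LocalClassicalScope) : Prop :=
  s.field.isCharZero = true ∧ s.type.isArthur = true ∧ s.form = .quasiSplit

/-- Region on which [Mok] STATES its local classification: quasi-split `U_{E/F}(N)` and `GL_N(E)`, `F` local of
characteristic zero, all parameters (`main.tex:L125` "quasi-split unitary groups"; Thm 2.5.1).
[cite: Mok2012, Thm 2.5.1 setting (arXiv l.1230-1242)] -/
abbrev Mok.localStated (s : LocalClassicalScope) : Prop :=
  s.field.isCharZero = true ∧ s.type.isMok = true ∧ s.form = .quasiSplit

end Packets

/-! ## §6  The intertwining leaves L16–L19 ([A25]–[A27]) and their 2026 suppliers -/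

section Intertwining

/-- generic shape of an intertwining identity asserted on region `R`: `iopLHS = iopRHS` on every instance.
[folklore] (identity-family shape; instances are World data, DIVERGENCE D-TY-03) -/
def IopIdentity (Ω : World) (R : LocalClassicalScope → Prop) : Prop :=
  ∀ s, R s → ∀ i : Ω.IopInst s, Ω.iopLHS s i = Ω.iopRHS s i

/-- Monotonicity of an intertwining identity in the region. [folklore] (bookkeeping) -/
theorem IopIdentity.mono (Ω : World) {R R' : LocalClassicalScope → Prop}
    (h : ∀ s, R' s → R s) : IopIdentity Ω R → IopIdentity Ω R' :=
  fun H s hs i => H s (h s hs) i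

/-- **L18 = [A27]a consumed region** — the Book Thm 2.5.1(b) / [Mok] Prop. 3.5.3(a): `F` local of
characteristic zero (ALL places), quasi-split `G` of Arthur resp. Mok type, tempered generic `π`
(second-hand: [AGIKMS] `note30.tex:L1924` "cf. {\cite[Theorem 2.5.1 (b)]{Ar}, \cite[Proposition 3.5.3 (a)]{Mok}}").
[cite: Arthur2013, Thm 2.5.1(b) setting (restated in AGIKMS2024 l.1924 and Mok2012 Prop. 3.5.3(a))] -/
abbrev L18.needed (s : LocalClassicalScope) : Prop :=
  s.field.isCharZero = true ∧ s.form = .quasiSplit ∧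
    (s.type.isArthur = true ∨ s.type.isMok = true) ∧ s.params = .temperedGeneric

/-- **L18 supplier: [AGIKMS] Thm `main1`** (Thm 1.8.1 of the v3 PDF), VERBATIM (`note30.tex:L1924–L1955`):
"\begin{thm}[cf. {\cite[Theorem 2.5.1 (b)]{Ar}, \cite[Proposition 3.5.3 (a)]{Mok}}]\label{main1} Let $\pi$ be
an irreducible $\ww_M$-generic tempered representation of $M$. (1) If $w \in W(M^\circ)$ satisfies that $w\pi
\cong \pi$, then \[ \Omega(w\pi) \circ R_P(w, \pi) = \left\{ \begin{aligned} &\Omega(\epsilon\pi) \circ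
L(\epsilon) \iif G = \O_{2n}(F), \, \det(w) = -1, \\ &\Omega(\pi) \other. \end{aligned} \right. \] Here \[
L(\epsilon) \colon I_P(\pi) \rightarrow I_{\epsilon P \epsilon^{-1}}(\epsilon \pi),\, (L(\epsilon)f)(g) =
f(\epsilon^{-1}g). \] (2) Suppose that $G = \GL_N(E)$. If $w \in W(M, \theta(M))$ satisfies that $w\pi \cong
\pi \circ \theta$, then \[ \Omega(w\pi) \circ R_P(w, \pi) = \Omega(\pi). \] \end{thm} This theorem is regarded
as the \emph{local intertwining relation} for generic tempered representations."  (Typographic flattening in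
this and the other VERBATIM blocks of this module: the source's `\begin{enumerate} \item … \end{enumerate}` is
rendered "(1) … (2) …"; otherwise the quotations are character-exact up to whitespace — cell GAPS G-REF-g12-4 (c).)
Setting: `L1065` "Fix a local field $F$ of characteristic zero."; `G` one of `SO_{2n+1}(F)`, `Sp_{2n}(F)`,
`O_{2n}(F)`, `U_n`, `GL_N(E)`, quasi-split.  Supplied ⊇ consumed (`L18.covered`).  STATUS: arXiv PREPRINT
2410.13504v3.
[claim: AGIKMS2024, under-review] (Thm 1.8.1 = `main1`, l.1924-1955) -/
abbrev L18.supplied (s : LocalClassicalScope) : Prop :=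
  s.field.isCharZero = true ∧ s.form = .quasiSplit ∧ s.params = .temperedGeneric

/-- L18: supplied ⊇ consumed (all places, archimedean included). [folklore] (bookkeeping) -/
theorem L18.covered : ∀ s, L18.needed s → L18.supplied s :=
  fun _ ⟨h1, h2, _, h4⟩ => ⟨h1, h2, h4⟩

/-- **L19 = [A27]b consumed region** — the Book Lemma 2.5.5 ([Mok] `src/1206.0882/main.tex:L7720` "We can
now apply Lemma 2.5.5 of \cite{A1}"): non-archimedean `F`, quasi-split `G` of Arthur / Mok type.
[cite: Arthur2013, Lemma 2.5.5 setting (restated in Mok2012 l.7720 and AGIKMS2024 l.13252, 13341-13345)] -/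
abbrev L19.needed (s : LocalClassicalScope) : Prop :=
  s.field.isPadic = true ∧ s.form = .quasiSplit ∧ (s.type.isArthur = true ∨ s.type.isMok = true)

/-- **L19 supplier: [AGIKMS] Appendix Thm `2.5.5`** (Thm D.2.1 of the v3 PDF), VERBATIM
(`note30.tex:L13407–L13413`): "\begin{thm}\label{2.5.5} Under the above assumptions, we have \[ e(s,u)=1. \] In
other words, Equation \eqref{A-LIR} in Section \ref{sec.main3} holds."  The assumptions (`L13341–L13345`): "Let
$F$ be a non-archimedean local field of characteristic zero and let $G$ be a quasi-split connected reductive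
$F$-group equipped with a Whittaker datum $\ww$. Let $P = MN$ be a proper parabolic subgroup of $G$ and let
$\phi_M$ be a tempered $L$-parameter for $M$. We assume the existence of an associated $L$-packet
$\Pi_{\phi_M}$." … (`L13404–L13405`) "We assume that this scalar is $1$. For classical groups, this follows from
Theorem \ref{main1} (1) together with Lemma \ref{c3}." — and `L13252`: "we can also remove the assumption in
\cite[Lemma 2.5.5]{Ar} that the residual characteristic of $F$ is odd."  STATUS: PREPRINT; for classical
groups its inputs are `main1` (L18) and known packet properties.  Supplied region: non-archimedean, quasi-split
(every connected reductive `G`).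
[claim: AGIKMS2024, under-review] (Thm D.2.1 = `2.5.5`, l.13341-13413) -/
abbrev L19.supplied (s : LocalClassicalScope) : Prop :=
  s.field.isPadic = true ∧ s.form = .quasiSplit

/-- L19: supplied ⊇ consumed. [folklore] (bookkeeping) -/
theorem L19.covered : ∀ s, L19.needed s → L19.supplied s := fun _ ⟨h1, h2, _⟩ => ⟨h1, h2⟩

/-- **L17 = [A26] consumed region** — the Book Thm 2.5.3 / [Mok] Prop. 3.5.1(b): `G = GL_N(E)`, `F` local of
characteristic zero (all places), every A-parameter of a Levi subgroup (second-hand: [AGIKMS] `note30.tex:L2020`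
"cf. {\cite[Theorem 2.5.3]{Ar}, \cite[Proposition 3.5.1 (b)]{Mok}}").
[cite: Arthur2013, Thm 2.5.3 setting (restated in AGIKMS2024 l.2019-2020)] -/
abbrev L17.needed (s : LocalClassicalScope) : Prop :=
  s.field.isCharZero = true ∧ (∃ N quad, s.type = .GL N quad) ∧ s.form = .quasiSplit

/-- **L17 supplier: [AGIKMS] Thm `main2`** (Thm 1.9.1 of the v3 PDF), VERBATIM (`note30.tex:L2019–L2029`):
"The second main theorem, which was supposed to be proven in \cite{A26}, is now stated as follows.
\begin{thm}[cf. {\cite[Theorem 2.5.3]{Ar}, \cite[Proposition 3.5.1 (b)]{Mok}}]\label{main2} Let $P=MN$ be a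
standard parabolic subgroup of $G=\GL_N(E)$, and let $\psi$ be an $A$-parameter for $M$. Then for any $w \in
W(\theta(M),M)$ with $w(\pi_\psi \circ \theta) \cong \pi_\psi$, we have \[ \tl{R}_P(\theta \circ w,
\tl{\pi}_\psi) = \theta_A. \] \end{thm} We can say that this theorem is the \emph{twisted local intertwining
relation} for $\GL_N(E)$."  (`F` any local field of characteristic zero, `L1065`; archimedean `E` included.)
Supplied = consumed.  STATUS: PREPRINT.
[claim: AGIKMS2024, under-review] (Thm 1.9.1 = `main2`, l.2019-2029) -/
abbrev L17.supplied (s : LocalClassicalScope) : Prop :=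
  s.field.isCharZero = true ∧ (∃ N quad, s.type = .GL N quad) ∧ s.form = .quasiSplit

/-- L17: supplied = consumed. [folklore] (bookkeeping) -/
theorem L17.covered : ∀ s, L17.needed s → L17.supplied s := fun _ h => h

/-- **L16 = [A25] consumed region** — the Book Lemma 7.1.2 "and the penultimate paragraph on p.~428, whose
proof was deferred to \cite{A25}" ([AGIKMS] `note30.tex:L486`); [Mok] §8.2: LIR/ECR for CO-TEMPERED parameters
at NON-ARCHIMEDEAN places.  (`L636–L637`, VERBATIM: "Note that this is a stronger statement than what is
claimed in \cite[Lemma 7.1.2]{Ar}, because it covers all co-tempered parameters, rather than the special class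
of tamely ramified quadratic co-tempered parameters.")
[cite: Arthur2013, Lemma 7.1.2 + p.428 setting (restated in AGIKMS2024 l.486, 636-637)] -/
abbrev L16.needed (s : LocalClassicalScope) : Prop :=
  s.field.isPadic = true ∧ s.form = .quasiSplit ∧
    (s.type.isArthur = true ∨ s.type.isMok = true) ∧ s.params = .cotempered

/-- **L16 supplier: [AGIKMS] Thm `main3`** (Thm 1.10.5 of the v3 PDF), setting `L2038`: "Assume that $F$ is a
non-archimedean local field of characteristic zero."; VERBATIM (`note30.tex:L2343–L2362`):
"\begin{thm}[cf. {\cite[Section 7.1]{Ar}, \cite[Section 8.2]{Mok}}]\label{main3} Assume Hypothesis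
\ref{hyp.arthur}. (1) For any co-tempered $A$-parameter $\psi = \widehat\phi \in \Psi(G)$, we can construct an
$A$-packet $\Pi_\psi$ together with a pairing $\pair{\cdot, \pi}_\psi$ for $\pi \in \Pi_\psi$ which satisfies
\eqref{ECR1} and \eqref{ECR2}. Moreover, $\Pi_\psi$ is a (multiplicity-free) subset of $\Irr(G)$. (2) Let
$P=MN_P$ be a parabolic subgroup of $G$ with $M \cong \GL_{k_t}(E) \times \dots \times \GL_{k_1}(E) \times G_0$,
and let $\psi_M = \widehat\phi_M = \psi_t \oplus \dots \oplus \psi_1 \oplus \psi_0$ be a co-tempered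
$A$-parameter for $M$ such that $\psi_i$ is irreducible and conjugate-self-dual for $1 \leq i \leq t$. Set $\psi
= \iota \circ \psi_M \in \Psi(G)$ with $\iota \colon {}^LM \hookrightarrow {}^LG$. Then \eqref{LIR} also holds
for every irreducible summand $\pi \subset I_P(\pi_M)$ for any $\pi_M \in \Pi_{\psi_M}$." (the source's
`\begin{enumerate} \item` rendered "(1)", "(2)", GAPS G-REF-g12-4 (c)).  Supplied = consumed MODULO `HypArthur` (an
induction-internal node, not a leaf) and modulo [AGIKMS]'s own preprint input [CK26] (the cell's L22).  STATUS:
PREPRINT.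
[claim: AGIKMS2024, under-review] (Thm 1.10.5 = `main3`, l.2343-2362) -/
abbrev L16.supplied (s : LocalClassicalScope) : Prop :=
  s.field.isPadic = true ∧ s.form = .quasiSplit ∧
    (s.type.isArthur = true ∨ s.type.isMok = true) ∧ s.params = .cotempered

/-- L16: supplied = consumed (modulo `HypArthur` and [CK26]). [folklore] (bookkeeping) -/
theorem L16.covered : ∀ s, L16.needed s → L16.supplied s := fun _ h => h

/-- **Hypothesis `hyp.arthur` of [AGIKMS]** (Hyp. 1.10.4 of the v3 PDF), VERBATIM (`note30.tex:L2327–L2338`):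
"\begin{hyp}\label{hyp.arthur} There are $A$-packets satisfying \eqref{ECR1}, \eqref{ECR2} and \eqref{A-LIR}
associated to \begin{itemize} \item all tempered $L$-parameters for $G$; \item all $A$-parameters for $G'$ with
$G'$ any classical group such that $\dim(\St_{\widehat{G'}}) < \dim(\St_{\widehat{G}})$. \end{itemize} In
particular, we have the $A$-packet $\Pi_{\psi_M}$ for $\psi_M \in \Psi(M)$, where $M$ is an arbitrary proper
Levi subgroup of $G$. \end{hyp}"  Typed as: the intertwining identity at the tempered slice of `s` (the second
bullet — the `dim St` order on smaller `G'` — is the induction hypothesis of the DAG, `Nodes.IH` of module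
`DependencyDag`, abstracted away here, DIVERGENCE D-TY-10).
[claim: AGIKMS2024, under-review] (Hypothesis 1.10.4 = `hyp.arthur`, l.2327-2338) -/
def HypArthur (Ω : World) (s : LocalClassicalScope) : Prop :=
  IopIdentity Ω (fun s' => s' = { s with params := .temperedGeneric })

/-- [AGIKMS] `main3` (2) as an edge: under `HypArthur`, the LIR at the co-tempered slice.
[claim: AGIKMS2024, under-review] (Thm 1.10.5 (2) as an implication; edge shape recorded here) -/
def AGIKMSMain3Edge (Ω : World) : Prop :=
  ∀ s, L16.supplied s → HypArthur Ω s → IopIdentity Ω (fun s' => s' = s)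

end Intertwining

end Literature.NumberTheory.Automorphic.Arthur2013.Leaves
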